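import Summits.NavierStokesRegularity.FluidComputer.PeriodicProfileAncientDss
import Literature.Analysis.FluidPDE.AncientMildOfClassical
import HarnessLib

/-!
# The exact periodic-profile object, classical near the blow-up time, is the terminal piece of an
# ancient MILD discretely self-similar solution: the formulation gap to the `rdssClass` floors closed

Summit `NavierStokesRegularity`, cell topic directory `FluidComputer`, namespace
`…FluidComputer.SelfSimilarCensus`; zone Z7 of the D-0081 profile search. Companion of
`PeriodicProfileAncientDss.lean` (the `P`-periodic profile `W(σ, ·)` in an ARBITRARY clock is the
terminal piece of a unique ancient `c`-DSS field, Type I in space–time given a `1/|y|` profile tail)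
and `DssGermAncientClassicalSolution.lean` (a CLASSICAL DSS germ extends to an ancient classical DSS
solution). Those files left one gap to the hypothesis class of the kernel floors `rdssClass_*`
(ancient MILD solution, (rotated) DSS, Type I, measurable slices, non-trivial): the solution
FORMULATION. The tree already holds the discharged Fabes–Jones–Rivière bridge
`IsClassicalNSSolutionOn.isAncientMildSolution_of_hasTypeIDecay` (`AncientMildOfClassical.lean`:
classical on `(−∞, 0)` + Type I + pressure bounded on every past slab ⇒ `IsAncientMildSolution ν`),
so the gap closes by composition once the PRESSURE of the extension is bounded on past slabs — which
follows from boundedness of the germ pressure on germ sub-slabs bounded away from the blow-up time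
(a minimal-admissible-index argument, §1). PROVED theorems only; no definitions, no named facts.

## Content

* §1 (pure scaling, any normed `E`) `inv_sq_mul_self_mem_Ioo`, **`exists_admissible_le`** (every
  `t < 0` has an admissible index `k`, `(c⁻¹)²ᵏ t ∈ (T₁, 0)`, whose germ time is moreover
  `≤ max (c⁻² T₁, t)` — bounded AWAY from the blow-up time), `nsRescalePressure_inv_pow_eq_of_dss_of_agree`
  (any globally DSS pressure through a pressure germ is the rescaled germ), and
  **`isBoundedOn_Iic_of_pressure_germ`** (germ pressure bounded on every `(T₁, s]`, `s < 0` ⇒ any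
  field with the pressure representation property is bounded on every past slab `(−∞, s]`).
* §2 (germ level, finite-dimensional inner-product `E`) **`exists_ancient_mild_dss_extension`** —
  `c > 1`, `T₁ < 0`, `ν > 0`; `(u, p)` classical unforced on `(T₁, 0)` with both germ relations,
  the Type-I bound `‖u(t, x)‖ ≤ C₀/(‖x‖ + √(−t))` on the germ and `p` bounded on every `(T₁, s]`,
  `s < 0`. Then the (unique) `c`-DSS extension `(ũ, p̃)` is an ancient CLASSICAL solution on
  `(−∞, 0)` AND an ancient MILD solution `IsAncientMildSolution ν ũ`, with `HasTypeIDecay C₀ ũ`,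
  `p̃` DSS and bounded on every past slab, all slices of `ũ` a.e.-strongly measurable, `ũ = 0` from
  the blow-up time on.
* §3 (the periodic-profile object; standing hypotheses of `PeriodicProfileClockRigidity` §4 with
  `T = 0`) `periodicProfile_germ_pair` (velocity AND pressure germ relations at every physical time
  of every `(θ(σ₁), 0)` with the SAME factor `c`: `p(t/c², x) = c² p(t, cx)`),
  `periodicProfile_pressure_isBoundedOn` (`|Q| ≤ B` ⇒ `|p| ≤ BM/(−s)` on `(θ(σ₁), s]`, from the
  gauge constant `(−θ)ℓ² ≤ M`), the headline **`periodicProfile_exists_ancient_mild_dss`** — if the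
  object is a classical solution on whole slices of ONE terminal slab `(θ(σ₁), 0) × E`, the profile
  pressure is bounded and the profile has the `1/|y|` tail, then there are `c > 1` and an ancient
  classical AND mild `c`-DSS solution `(ũ, p̃)` on `(−∞, 0)` through the object (equal to it at every
  physical time of every `(θ(σ₂), 0)`), Type I in space–time, measurable, non-trivial at every
  `t < 0`, zero from the blow-up time on — and **`periodicProfile_rdssClass_hypotheses`**: the same
  `ũ` satisfies, BY NAME, every structural hypothesis of `rdssClass_classicalRepresentative` and of
  the `rdssClass_*` floors: `IsAncientMildSolution ν ũ`, measurable slices,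
  `IsRotatedDSS c (LinearIsometryEquiv.refl ℝ E) ũ`, `HasTypeIDecay C₀ ũ`, `ũ(t) ≢ 0` for `t < 0`.

READING for the Z7 row (lead's pen): the LEDGER col-9 sentence «separated only by solution
FORMULATION» is discharged for objects that are classical on whole slices of a terminal slab with
bounded profile pressure: such an exact Z7 object IS the terminal piece of a member of the
hypothesis class of the (K-a) floors (at its viscosity `ν`; the floors' `ν = 1` is the normalisation
`IsClassicalNSSolutionOn.viscosityRescale_set`), so each floor `rdssClass_⋯_empty` whose structural
side condition the profile meets is a theorem about the object itself.

WHAT THIS IS NOT: not an existence or non-existence claim for such objects, not a verification that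
any computed profile is classical up to the blow-up time (that is the hypothesis `hcl`), not
Navier–Stokes evidence; «violates: none — no object».

Tree search: `lean search 'isAncientMildSolution_of|AncientMild'` — `IsClassicalNSSolutionOn.isAncientMildSolution_of_isBoundedOn`
/ `_of_hasTypeIDecay` (used here), `IsTypeIAncientMild.*` (the converse direction, mild ⇒ classical);
nothing about germs or pressure past-slab bounds.

References: E. B. Fabes, B. F. Jones, N. M. Rivière, ARMA 45 (1972), Thm. 2.1
[FabesJonesRiviere1972]; G. Koch, N. Nadirashvili, G. Seregin, V. Šverák, Acta Math. 203 (2009),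
§1 (1.3)–(1.6) [KochNadirashviliSereginSverak2009]; D. Chae, J. Wolf, ARMA 225 (2017), Def. 1.1
[ChaeWolf2017RemovingDSS]; Z. Bradshaw, T.-P. Tsai, Analysis & PDE 12 (2019), §4.2 [BradshawTsai2019].
-/

noncomputable section

open Set Filter Topology Function MeasureTheory
open scoped Laplacian RealInnerProductSpace

namespace Summit.NavierStokesRegularity.FluidComputer.SelfSimilarCensus

open Literature.Analysis.FluidPDE Literature.Analysis.FluidPDE.BradshawTsai2019

/-! ### §1 Minimal admissible indices; pressure representation; past-slab bounds (pure scaling) -/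

section Scaling

variable {E : Type*} [NormedAddCommGroup E] [NormedSpace ℝ E]
variable {c T₁ : ℝ}

/-- One germ step of the left end point stays in the germ interval: `c⁻² T₁ ∈ (T₁, 0)` for
`T₁ < 0`, `c > 1`. [folklore] -/
theorem inv_sq_mul_self_mem_Ioo (hc : 1 < c) (hT₁ : T₁ < 0) : c⁻¹ ^ 2 * T₁ ∈ Ioo T₁ 0 := by
  have hc0 : 0 < c := zero_lt_one.trans hc
  have h1 : c⁻¹ ^ 2 < 1 := by
    rw [inv_pow]; exact inv_lt_one_of_one_lt₀ (by nlinarith)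
  have h2 : 0 < c⁻¹ ^ 2 := by positivity
  exact ⟨by nlinarith, by nlinarith⟩

/-- **Minimal admissible index.** For `t < 0` (`T₁ < 0`, `c > 1`) there is `k : ℕ` with
`(c⁻¹)²ᵏ t ∈ (T₁, 0)` AND `(c⁻¹)²ᵏ t ≤ max (c⁻² T₁) t`: the germ time of the least admissible index
is bounded away from the blow-up time (`k = 0`: it is `t`; `k ≥ 1`: the previous index was not
admissible, `(c⁻¹)²⁽ᵏ⁻¹⁾ t ≤ T₁`, so one more step lands in `(T₁, c⁻² T₁]`). [folklore] -/
theorem exists_admissible_le (hc : 1 < c) (hT₁ : T₁ < 0) {t : ℝ} (ht : t < 0) :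
    ∃ k : ℕ, (c⁻¹ ^ k) ^ 2 * t ∈ Ioo T₁ 0 ∧ (c⁻¹ ^ k) ^ 2 * t ≤ max (c⁻¹ ^ 2 * T₁) t := by
  classical
  have hc0 : 0 < c := zero_lt_one.trans hc
  have hex := exists_admissible_of_neg hc hT₁ ht
  obtain ⟨k, hk, hmin⟩ : ∃ k, (c⁻¹ ^ k) ^ 2 * t ∈ Ioo T₁ 0 ∧
      ∀ j < k, (c⁻¹ ^ j) ^ 2 * t ∉ Ioo T₁ 0 :=
    ⟨Nat.find hex, Nat.find_spec hex, fun j hj => Nat.find_min hex hj⟩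
  refine ⟨k, hk, ?_⟩
  cases k with
  | zero => simp only [pow_zero, one_pow, one_mul]; exact le_max_right _ _
  | succ k =>
    have hj := hmin k (Nat.lt_succ_self k)
    have hneg : (c⁻¹ ^ k) ^ 2 * t < 0 := mul_neg_of_pos_of_neg (by positivity) ht
    have hle : (c⁻¹ ^ k) ^ 2 * t ≤ T₁ := by
      by_contra h
      exact hj ⟨not_le.1 h, hneg⟩
    have h2 : 0 ≤ c⁻¹ ^ 2 := by positivity
    calc (c⁻¹ ^ (k + 1)) ^ 2 * t = c⁻¹ ^ 2 * ((c⁻¹ ^ k) ^ 2 * t) := by ring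
      _ ≤ c⁻¹ ^ 2 * T₁ := mul_le_mul_of_nonneg_left hle h2
      _ ≤ max (c⁻¹ ^ 2 * T₁) t := le_max_left _ _

/-- **Any globally DSS pressure through a pressure germ is the rescaled germ** (twin of
`nsRescale_inv_pow_eq_of_dss_of_agree`): if `nsRescalePressure c q = q` (`c ≠ 0`) and `q t = p t`
for `t ∈ (T₁, 0)`, then `q t = nsRescalePressure (c⁻¹)ᵏ p t` whenever `(c⁻¹)²ᵏ t ∈ (T₁, 0)`.
[folklore] -/
theorem nsRescalePressure_inv_pow_eq_of_dss_of_agree (hc : c ≠ 0) {p q : ℝ → E → ℝ}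
    (hq : nsRescalePressure c q = q) (hagree : ∀ t ∈ Ioo T₁ 0, q t = p t) (k : ℕ) (t : ℝ)
    (ht : (c⁻¹ ^ k) ^ 2 * t ∈ Ioo T₁ 0) : q t = nsRescalePressure (c⁻¹ ^ k) p t := by
  have hq' : nsRescalePressure (c⁻¹ ^ k) q = q :=
    nsRescalePressure_pow_eq (nsRescalePressure_inv_eq hc hq) k
  funext x
  rw [← hq', nsRescalePressure_apply, nsRescalePressure_apply, hagree _ ht]

/-- **PAST-SLAB BOUNDS FROM GERM SUB-SLAB BOUNDS (pressure-type fields).** Let `c > 1`, `T₁ < 0`,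
and let the germ `p` be bounded on every germ sub-slab `(T₁, s] × E`, `s ∈ (T₁, 0)`. Then any `q`
with the representation property `q t = nsRescalePressure (c⁻¹)ᵏ p t` for all admissible `k` (the
extension of `exists_dssPressure_extension`, or any DSS pressure through the germ by
`nsRescalePressure_inv_pow_eq_of_dss_of_agree`) is bounded on every past slab `(−∞, s] × E`,
`s < 0`: by `exists_admissible_le` the value `q(t, x) = a² p(a² t, a x)`, `a = (c⁻¹)ᵏ ≤ 1`, reads
`p` at a germ time in `(T₁, max (c⁻² T₁, s)]`. [folklore] -/
theorem isBoundedOn_Iic_of_pressure_germ {p q : ℝ → E → ℝ} (hc : 1 < c) (hT₁ : T₁ < 0)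
    (hpb : ∀ s ∈ Ioo T₁ 0, IsBoundedOn (Ioc T₁ s) p)
    (hqrep : ∀ (k : ℕ) (t : ℝ), (c⁻¹ ^ k) ^ 2 * t ∈ Ioo T₁ 0 →
      q t = nsRescalePressure (c⁻¹ ^ k) p t)
    {s : ℝ} (hs : s < 0) : IsBoundedOn (Iic s) q := by
  have hc0 : 0 < c := zero_lt_one.trans hc
  have hT := inv_sq_mul_self_mem_Ioo hc hT₁
  have hs' : max (c⁻¹ ^ 2 * T₁) s ∈ Ioo T₁ 0 := ⟨lt_max_of_lt_left hT.1, max_lt hT.2 hs⟩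
  obtain ⟨B, hB⟩ := hpb _ hs'
  refine ⟨B, fun t ht x => ?_⟩
  have htneg : t < 0 := lt_of_le_of_lt ht hs
  obtain ⟨k, hk, hkle⟩ := exists_admissible_le hc hT₁ htneg
  have ha : 0 < c⁻¹ ^ k := by positivity
  have ha1 : c⁻¹ ^ k ≤ 1 := pow_le_one₀ (by positivity) (inv_le_one_of_one_le₀ hc.le)
  have hτ : (c⁻¹ ^ k) ^ 2 * t ∈ Ioc T₁ (max (c⁻¹ ^ 2 * T₁) s) :=
    ⟨hk.1, hkle.trans (max_le_max le_rfl ht)⟩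
  have h1 := hB _ hτ ((c⁻¹ ^ k) • x)
  rw [Real.norm_eq_abs] at h1
  rw [hqrep k t hk, nsRescalePressure_apply, Real.norm_eq_abs, abs_mul, abs_of_nonneg (sq_nonneg _)]
  calc (c⁻¹ ^ k) ^ 2 * |p ((c⁻¹ ^ k) ^ 2 * t) ((c⁻¹ ^ k) • x)| ≤ 1 * B :=
        mul_le_mul (pow_le_one₀ ha.le ha1) h1 (abs_nonneg _) zero_le_one
    _ = B := one_mul B

end Scaling

/-! ### §2 Germ level: the ancient classical DSS extension is an ancient MILD solution -/

section Germ

variable {E : Type*} [NormedAddCommGroup E] [InnerProductSpace ℝ E] [FiniteDimensional ℝ E]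
  [MeasurableSpace E] [BorelSpace E]
variable {u : ℝ → E → E} {p : ℝ → E → ℝ} {c T₁ ν C₀ : ℝ}

/-- **A CLASSICAL TYPE-I DSS GERM IS THE TERMINAL PIECE OF AN ANCIENT MILD DSS SOLUTION.** Let
`c > 1`, `T₁ < 0`, `ν > 0`, and let `(u, p)` be a classical solution of the unforced Navier–Stokes
system on `(T₁, 0)` with the germ relations `nsRescale c⁻¹ u t = u t`, `nsRescalePressure c⁻¹ p t = p t`
there, the Type-I bound `‖u(t, x)‖ ≤ C₀/(‖x‖ + √(−t))` on the germ, and `p` bounded on every germ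
sub-slab `(T₁, s] × E`, `s ∈ (T₁, 0)`. Then there are `(ũ, p̃)` with: `IsDiscretelySelfSimilar c ũ`,
`nsRescalePressure c p̃ = p̃`; `ũ = u`, `p̃ = p` on `(T₁, 0)`; `IsClassicalNSSolutionOn (Iio 0) ν 0 ũ p̃`
(ancient classical); **`IsAncientMildSolution ν ũ`** (ancient MILD — the formulation of the
`rdssClass_*` floors; Fabes–Jones–Rivière via the tree's
`IsClassicalNSSolutionOn.isAncientMildSolution_of_hasTypeIDecay`); `HasTypeIDecay C₀ ũ`; `p̃` bounded
on every past slab; every slice of `ũ` a.e.-strongly measurable; `ũ t = 0` for `t ≥ 0`. (Unique among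
`c`-DSS fields through the germ: `dss_extension_unique`.) [cite: FabesJonesRiviere1972, Thm. 2.1] -/
theorem exists_ancient_mild_dss_extension (hc : 1 < c) (hT₁ : T₁ < 0) (hν : 0 < ν)
    (hsol : IsClassicalNSSolutionOn (Ioo T₁ 0) ν 0 u p)
    (hu : ∀ t ∈ Ioo T₁ 0, nsRescale c⁻¹ u t = u t)
    (hp : ∀ t ∈ Ioo T₁ 0, nsRescalePressure c⁻¹ p t = p t)
    (hTI : ∀ t ∈ Ioo T₁ 0, ∀ x : E, ‖u t x‖ ≤ C₀ / (‖x‖ + Real.sqrt (-t)))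
    (hpb : ∀ s ∈ Ioo T₁ 0, IsBoundedOn (Ioc T₁ s) p) :
    ∃ (v : ℝ → E → E) (q : ℝ → E → ℝ), IsDiscretelySelfSimilar c v ∧ nsRescalePressure c q = q ∧
      (∀ t ∈ Ioo T₁ 0, v t = u t) ∧ (∀ t ∈ Ioo T₁ 0, q t = p t) ∧
      IsClassicalNSSolutionOn (Iio 0) ν 0 v q ∧ IsAncientMildSolution ν v ∧ HasTypeIDecay C₀ v ∧
      (∀ t < 0, IsBoundedOn (Iic t) q) ∧ (∀ t, AEStronglyMeasurable (v t) volume) ∧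
      ∀ t, 0 ≤ t → v t = 0 := by
  have hc0 : 0 < c := zero_lt_one.trans hc
  obtain ⟨v, hvdss, hvu, hvrep, hv0⟩ := exists_dss_extension hc hT₁ hu
  obtain ⟨q, hqdss, hqp, hqrep, -⟩ := exists_dssPressure_extension hc hT₁ hp
  -- ancient classical (the argument of `exists_ancient_classical_dss_extension`, kept with the
  -- representation properties of THIS `(v, q)`)
  have hcl : IsClassicalNSSolutionOn (Iio 0) ν 0 v q := by
    refine isClassicalNSSolutionOn_of_locally isOpen_Iio fun t ht => ?_
    obtain ⟨k, hk⟩ := exists_admissible_of_neg hc hT₁ ht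
    obtain ⟨hVopen, hVsub⟩ := isOpen_admissibleSet_and_subset c k T₁
    have ha : 0 < c⁻¹ ^ k := by positivity
    have hres : IsClassicalNSSolutionOn ((fun s : ℝ => (c⁻¹ ^ k) ^ 2 * s) ⁻¹' Ioo T₁ 0) ν 0
        (nsRescale (c⁻¹ ^ k) u) (nsRescalePressure (c⁻¹ ^ k) p) := by
      have h := IsClassicalNSSolutionOn.nsRescale_holds hsol ha
      rwa [nsRescaleForce_zero] at h
    exact ⟨_, hVopen, hk, hVsub, _, _, hres, fun s hs => hvrep k s hs, fun s hs => hqrep k s hs⟩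
  have hTIv : HasTypeIDecay C₀ v := hasTypeIDecay_of_germ hc hT₁ hTI hvrep
  have hqb : ∀ t < 0, IsBoundedOn (Iic t) q := fun t ht =>
    isBoundedOn_Iic_of_pressure_germ hc hT₁ hpb hqrep ht
  refine ⟨v, q, hvdss, hqdss, hvu, hqp, hcl, hcl.isAncientMildSolution_of_hasTypeIDecay hν hTIv hqb,
    hTIv, hqb, fun t => ?_, hv0⟩
  by_cases ht : t < 0
  · exact (hcl.contDiff_velocity (show t ∈ Iio (0 : ℝ) from ht)).continuous.aestronglyMeasurable
  · rw [hv0 t (not_lt.1 ht)]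
    exact aestronglyMeasurable_const

end Germ

/-! ### §3 The periodic-profile object -/

section PeriodicProfile

variable {E : Type*} [NormedAddCommGroup E] [InnerProductSpace ℝ E] [FiniteDimensional ℝ E]
variable {W : ℝ → E → E} {Q : ℝ → E → ℝ} {u : ℝ → E → E} {p : ℝ → E → ℝ}
  {ℓ ℓ' θ : ℝ → ℝ} {ν P σ₀ : ℝ}

/-! Standing hypotheses = those of `PeriodicProfileClockRigidity` §4 / `PeriodicProfileAncientDss`
§2, verbatim (open half-line `σ > σ₀`: `ℓ > 0` with derivative `ℓ′`, `θ′ = ℓ⁻²`; `P > 0`; `W`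
jointly `C¹`, `P`-periodic, every slice `W(σ, ·) ≢ 0`; `Q` `P`-periodic; ansatz, pressure ansatz,
differentiability and the momentum equation at the clock times; any `ν`), with the blow-up time
normalised to `0`: `θ(σ) → 0` (hypothesis `hT` of each theorem). -/
variable (hP : 0 < P) (hℓ : ∀ σ, σ₀ < σ → HasDerivAt ℓ (ℓ' σ) σ) (hpos : ∀ σ, σ₀ < σ → 0 < ℓ σ)
  (hθ : ∀ σ, σ₀ < σ → HasDerivAt θ ((ℓ σ ^ 2)⁻¹) σ) (hW : ContDiff ℝ 1 (uncurry W))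
  (hper : ∀ s, W (s + P) = W s) (hperQ : ∀ s, Q (s + P) = Q s)
  (hW0 : ∀ σ, σ₀ < σ → W σ ≠ 0)
  (hans : ∀ σ, σ₀ < σ → ∀ x, u (θ σ) x = ℓ σ • W σ (ℓ σ • x))
  (hp : ∀ σ, σ₀ < σ → p (θ σ) = fun x => ℓ σ ^ 2 * Q σ (ℓ σ • x))
  (hu : ∀ σ, σ₀ < σ → ∀ x, DifferentiableAt ℝ (fun t => u t x) (θ σ))
  (heq : ∀ σ, σ₀ < σ → ∀ x : E,
    timeDeriv u (θ σ) x + convect (u (θ σ)) (u (θ σ)) x + gradient (p (θ σ)) x -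
      ν • (Δ (u (θ σ))) x = 0)
include hP hℓ hpos hθ hW hper hperQ hW0 hans hp hu heq

/-- **VELOCITY AND PRESSURE GERM RELATIONS WITH THE SAME FACTOR.** On the blow-up branch there is
`c > 1` such that for every `σ₁ > σ₀` and EVERY physical time `t ∈ (θ(σ₁), 0)`:
`nsRescale c⁻¹ u t = u t` (`u(t, x) = c⁻¹ u(t/c², c⁻¹x)`) and `nsRescalePressure c⁻¹ p t = p t`
(`p(t, x) = c⁻² p(t/c², c⁻¹x)`, i.e. `p(t/c², y) = c² p(t, c y)`): one period later the clock time is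
`θ(σ)/c²`, the gauge is `c ℓ(σ)` (`periodicProfile_blowup_rigidity`), and `Q` is `P`-periodic.
[folklore] -/
theorem periodicProfile_germ_pair (hT : Tendsto θ atTop (𝓝 0)) :
    ∃ c : ℝ, 1 < c ∧ ∀ σ₁, σ₀ < σ₁ → ∀ t ∈ Ioo (θ σ₁) 0,
      nsRescale c⁻¹ u t = u t ∧ nsRescalePressure c⁻¹ p t = p t := by
  obtain ⟨c, hc, hcl, hfix, -, hcov, -⟩ :=
    periodicProfile_blowup_rigidity hP hℓ hpos hθ hW hper hperQ hW0 hans hp hu heq hT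
  have hc0 : 0 < c := zero_lt_one.trans hc
  refine ⟨c, hc, fun σ₁ hσ₁ t ht => ?_⟩
  obtain ⟨σ, hσ, rfl⟩ := periodicProfile_exists_clockTime hθ hT hσ₁ ht
  have hσ₀ : σ₀ < σ := hσ₁.trans hσ
  have hθP : θ (σ + P) = c⁻¹ ^ 2 * θ σ := by
    have h := hfix σ hσ₀
    rw [zero_sub, zero_sub, neg_div, neg_inj] at h
    rw [h, inv_pow, div_eq_inv_mul]
  refine ⟨funext fun x => ?_, funext fun x => ?_⟩
  · have h2 := hcov σ hσ₀ (c⁻¹ • x)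
    rw [smul_smul, mul_inv_cancel₀ hc0.ne', one_smul, zero_sub, zero_sub, neg_div, neg_neg] at h2
    rw [nsRescale_apply, inv_pow, ← div_eq_inv_mul, h2, smul_smul, inv_mul_cancel₀ hc0.ne', one_smul]
  · have hkey : c⁻¹ ^ 2 * (c * ℓ σ) ^ 2 = ℓ σ ^ 2 := by field_simp
    have hsm : (c * ℓ σ * c⁻¹) • x = ℓ σ • x := by
      rw [mul_comm c (ℓ σ), mul_inv_cancel_right₀ hc0.ne']
    rw [nsRescalePressure_apply, ← hθP, hp (σ + P) (by linarith), hp σ hσ₀]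
    simp only [hperQ, hcl σ hσ₀, smul_smul]
    rw [hsm, ← mul_assoc, hkey]

/-- **PRESSURE BOUND ON GERM SUB-SLABS FROM A BOUNDED PROFILE PRESSURE.** If `|Q(σ, y)| ≤ B` for all
`σ > σ₀`, `y`, then on every germ sub-slab `(θ(σ₁), s] × E`, `s ∈ (θ(σ₁), 0)`, `σ₁ > σ₀`, the
physical pressure is bounded, `|p(t, x)| ≤ B M/(−s)`: at the clock time `t = θ(σ) ≤ s` one has
`|p| = ℓ(σ)² |Q| ≤ ℓ(σ)² B` and `ℓ(σ)² ≤ M/(−θ(σ)) ≤ M/(−s)` by the upper gauge constant of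
`periodicProfile_blowup_rigidity`. [folklore] -/
theorem periodicProfile_pressure_isBoundedOn (hT : Tendsto θ atTop (𝓝 0)) {B : ℝ}
    (hQb : ∀ σ, σ₀ < σ → ∀ y : E, |Q σ y| ≤ B) {σ₁ : ℝ} (hσ₁ : σ₀ < σ₁)
    {s : ℝ} (hs : s ∈ Ioo (θ σ₁) 0) : IsBoundedOn (Ioc (θ σ₁) s) p := by
  obtain ⟨c, -, -, -, hlt, -, m, M, hm, hmM, hbd⟩ :=
    periodicProfile_blowup_rigidity hP hℓ hpos hθ hW hper hperQ hW0 hans hp hu heq hT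
  have hB0 : 0 ≤ B := (abs_nonneg _).trans (hQb (σ₀ + 1) (lt_add_one σ₀) 0)
  have hM : 0 < M := hm.trans_le hmM
  have hs0 : 0 < -s := by linarith [hs.2]
  refine ⟨B * M / (-s), fun t ht x => ?_⟩
  obtain ⟨σ, hσ, rfl⟩ :=
    periodicProfile_exists_clockTime hθ hT hσ₁ ⟨ht.1, lt_of_le_of_lt ht.2 hs.2⟩
  have hσ₀ : σ₀ < σ := hσ₁.trans hσ
  have hθneg : 0 < -θ σ := by linarith [hlt σ hσ₀]
  have hℓ2 : ℓ σ ^ 2 ≤ M / (-θ σ) := by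
    rw [le_div_iff₀ hθneg]
    calc ℓ σ ^ 2 * -θ σ = (0 - θ σ) * ℓ σ ^ 2 := by ring
      _ ≤ M := (hbd σ hσ₀).2
  have hθs : -θ σ ≥ -s := by linarith [ht.2]
  rw [hp σ hσ₀, Real.norm_eq_abs, abs_mul, abs_of_nonneg (sq_nonneg _)]
  calc ℓ σ ^ 2 * |Q σ (ℓ σ • x)| ≤ M / (-θ σ) * B :=
        mul_le_mul hℓ2 (hQb σ hσ₀ _) (abs_nonneg _) (by positivity)
    _ ≤ M / (-s) * B :=
        mul_le_mul_of_nonneg_right (div_le_div_of_nonneg_left hM.le hs0 hθs) hB0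
    _ = B * M / (-s) := by ring

variable [MeasurableSpace E] [BorelSpace E]

/-- **THE OBJECT IS THE TERMINAL PIECE OF AN ANCIENT MILD DSS SOLUTION.** Assume in addition that
`ν > 0`, that `(u, p)` is a CLASSICAL solution of the unforced Navier–Stokes system on one terminal
slab `(θ(σ₁), 0) × E`, `σ₁ > σ₀` (whole slices), that the profile pressure is bounded, `|Q| ≤ B`,
and that the profile has the Type-I tail `‖W(σ, y)‖ ≤ K/(1 + ‖y‖)`. Then there are `c > 1` and
`(ũ, p̃)` with: `IsDiscretelySelfSimilar c ũ`, `nsRescalePressure c p̃ = p̃`; `ũ = u` at every physical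
time of every `(θ(σ₂), 0)`, `σ₂ > σ₀`, and `p̃ = p` on `(θ(σ₁), 0)`; `IsClassicalNSSolutionOn (Iio 0) ν 0 ũ p̃`;
**`IsAncientMildSolution ν ũ`**; `HasTypeIDecay C₀ ũ` for some `C₀`; `p̃` bounded on every past
slab; all slices of `ũ` a.e.-strongly measurable; `ũ t = 0` for `t ≥ 0`; and `ũ t ≢ 0` for every
`t < 0`. (`periodicProfile_germ_pair` + `periodicProfile_typeI_spaceTime` +
`periodicProfile_pressure_isBoundedOn` feed `exists_ancient_mild_dss_extension` on the germ slab
`(θ(σ₁), 0)`; agreement on larger slabs by the representation of any DSS field through the germ;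
non-triviality from `W(σ, ·) ≢ 0` at the clock time `(c⁻¹)²ᵏ t`.) [cite: FabesJonesRiviere1972, Thm. 2.1] -/
theorem periodicProfile_exists_ancient_mild_dss (hT : Tendsto θ atTop (𝓝 0)) (hν : 0 < ν)
    {σ₁ : ℝ} (hσ₁ : σ₀ < σ₁) (hcl : IsClassicalNSSolutionOn (Ioo (θ σ₁) 0) ν 0 u p)
    {B : ℝ} (hQb : ∀ σ, σ₀ < σ → ∀ y : E, |Q σ y| ≤ B)
    {K : ℝ} (hK : ∀ σ, σ₀ < σ → ∀ y : E, ‖W σ y‖ ≤ K / (1 + ‖y‖)) :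
    ∃ c : ℝ, 1 < c ∧ ∃ (v : ℝ → E → E) (q : ℝ → E → ℝ),
      IsDiscretelySelfSimilar c v ∧ nsRescalePressure c q = q ∧
      (∀ σ₂, σ₀ < σ₂ → ∀ t ∈ Ioo (θ σ₂) 0, v t = u t) ∧ (∀ t ∈ Ioo (θ σ₁) 0, q t = p t) ∧
      IsClassicalNSSolutionOn (Iio 0) ν 0 v q ∧ IsAncientMildSolution ν v ∧
      (∃ C₀, HasTypeIDecay C₀ v) ∧ (∀ t < 0, IsBoundedOn (Iic t) q) ∧
      (∀ t, AEStronglyMeasurable (v t) volume) ∧ (∀ t, 0 ≤ t → v t = 0) ∧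
      ∀ t < 0, v t ≠ 0 := by
  obtain ⟨c, hc, hgerm⟩ :=
    periodicProfile_germ_pair hP hℓ hpos hθ hW hper hperQ hW0 hans hp hu heq hT
  have hc0 : 0 < c := zero_lt_one.trans hc
  have hT₁ : θ σ₁ < 0 := periodicProfile_time_lt hP hpos hθ hT hσ₁
  obtain ⟨C₀, hC₀⟩ :=
    periodicProfile_typeI_spaceTime hP hℓ hpos hθ hW hper hperQ hW0 hans hp hu heq hT hK
  have hpb : ∀ s ∈ Ioo (θ σ₁) 0, IsBoundedOn (Ioc (θ σ₁) s) p := fun s hs =>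
    periodicProfile_pressure_isBoundedOn hP hℓ hpos hθ hW hper hperQ hW0 hans hp hu heq hT hQb hσ₁ hs
  obtain ⟨v, q, hv, hq, hvu, hqp, hvcl, hmild, hTI, hqb, hmeas, hv0⟩ :=
    exists_ancient_mild_dss_extension hc hT₁ hν hcl (fun t ht => (hgerm σ₁ hσ₁ t ht).1)
      (fun t ht => (hgerm σ₁ hσ₁ t ht).2) (hC₀ σ₁ hσ₁) hpb
  refine ⟨c, hc, v, q, hv, hq, fun σ₂ hσ₂ t ht => ?_, hqp, hvcl, hmild, ⟨C₀, hTI⟩, hqb, hmeas, hv0,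
    fun t ht hvt => ?_⟩
  · -- agreement on every `(θ σ₂, 0)`: representation of `v` through the germ + germ iteration
    obtain ⟨k, hk⟩ := exists_admissible_of_neg hc hT₁ ht.2
    rw [nsRescale_inv_pow_eq_of_dss_of_agree hc0.ne' hv hvu k t hk]
    exact nsRescale_inv_pow_eq_of_germ hc (fun s hs => (hgerm σ₂ hσ₂ s hs).1) k t ht
  · -- non-triviality: `v t` is a rescaled copy of the slice at the clock time `(c⁻¹)²ᵏ t = θ σ`
    obtain ⟨k, hk⟩ := exists_admissible_of_neg hc hT₁ ht
    obtain ⟨σ, hσ, hσt⟩ := periodicProfile_exists_clockTime hθ hT hσ₁ hk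
    have hσ₀ : σ₀ < σ := hσ₁.trans hσ
    have ha : c⁻¹ ^ k ≠ 0 := by positivity
    have hrep := nsRescale_inv_pow_eq_of_dss_of_agree hc0.ne' hv hvu k t hk
    refine hW0 σ hσ₀ (funext fun y => ?_)
    have h1 := congrFun hrep ((c⁻¹ ^ k)⁻¹ • (ℓ σ)⁻¹ • y)
    rw [hvt, Pi.zero_apply, nsRescale_apply, smul_smul (c⁻¹ ^ k) (c⁻¹ ^ k)⁻¹, mul_inv_cancel₀ ha,
      one_smul, ← hσt, hans σ hσ₀, smul_smul (ℓ σ) (ℓ σ)⁻¹, mul_inv_cancel₀ (hpos σ hσ₀).ne',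
      one_smul, eq_comm, smul_eq_zero, smul_eq_zero] at h1
    rcases h1 with h | h | h
    · exact absurd h ha
    · exact absurd h (hpos σ hσ₀).ne'
    · exact h

/-- **IN THE VOCABULARY OF THE `rdssClass` FLOORS.** Under the hypotheses of
`periodicProfile_exists_ancient_mild_dss` there are `c > 1`, a field `ũ` and a constant `C₀` such
that `ũ` coincides with the object at every physical time of every `(θ(σ₂), 0)`, `σ₂ > σ₀`, and
satisfies, BY NAME, every structural hypothesis of `rdssClass_classicalRepresentative` and of the
(K-a) floors `rdssClass_⋯`: `IsAncientMildSolution ν ũ` (ancient mild), measurable slices,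
`IsRotatedDSS c (LinearIsometryEquiv.refl ℝ E) ũ` (rotated DSS with the trivial rotation,
`isRotatedDSS_refl_iff`), `HasTypeIDecay C₀ ũ` (space–time Type I, KNSS 2009 (1.6)), and
`ũ(t) ≢ 0` for every `t < 0` (non-trivial) — at the object's viscosity `ν`.
[cite: KochNadirashviliSereginSverak2009, §1 (1.3)–(1.6)] -/
theorem periodicProfile_rdssClass_hypotheses (hT : Tendsto θ atTop (𝓝 0)) (hν : 0 < ν)
    {σ₁ : ℝ} (hσ₁ : σ₀ < σ₁) (hcl : IsClassicalNSSolutionOn (Ioo (θ σ₁) 0) ν 0 u p)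
    {B : ℝ} (hQb : ∀ σ, σ₀ < σ → ∀ y : E, |Q σ y| ≤ B)
    {K : ℝ} (hK : ∀ σ, σ₀ < σ → ∀ y : E, ‖W σ y‖ ≤ K / (1 + ‖y‖)) :
    ∃ c : ℝ, 1 < c ∧ ∃ (v : ℝ → E → E) (C₀ : ℝ),
      (∀ σ₂, σ₀ < σ₂ → ∀ t ∈ Ioo (θ σ₂) 0, v t = u t) ∧
      IsAncientMildSolution ν v ∧ (∀ t < 0, AEStronglyMeasurable (v t) volume) ∧
      IsRotatedDSS c (LinearIsometryEquiv.refl ℝ E) v ∧ HasTypeIDecay C₀ v ∧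
      ∀ t < 0, v t ≠ 0 := by
  obtain ⟨c, hc, v, q, hv, -, hvu, -, -, hmild, ⟨C₀, hTI⟩, -, hmeas, -, hne⟩ :=
    periodicProfile_exists_ancient_mild_dss hP hℓ hpos hθ hW hper hperQ hW0 hans hp hu heq hT hν
      hσ₁ hcl hQb hK
  exact ⟨c, hc, v, C₀, hvu, hmild, fun t _ => hmeas t, isRotatedDSS_refl_iff.2 hv, hTI, hne⟩

end PeriodicProfile

end Summit.NavierStokesRegularity.FluidComputer.SelfSimilarCensus

end
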